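import Summits.AnomalousDissipation.AnomalousDissipation.Theorems.SolenoidalFractalHomogenisationPermissibleFractalCarrierWords

/-!
# Fractal shear carriers in time: continuity of the slot envelopes and periodicity of the levels
(route `AnomalousDissipation/SolenoidalFractalHomogenisation`, crux K3 = stmt-AnomalousDissipation-19073
`PermissibleFractalCarrier`, towards the registered stub `stub_regular`; support seat ad-sawtooth-support g7)

* §1 slots of a word: `0 ≤ start j`, `start j + τ j ≤ period`, `0 < period`; the periodically replayed envelope
  `t ↦ trapezoid_j (fract (a t / period) · period)` is continuous (it vanishes at both ends of the period, so the
  jump of `fract` is invisible);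
* §2 the level fields are continuous in time in every `C^{0,r}`, `r ≤ 1`
  (`tendsto_eBoundedHolderNorm_level_sub`);
* §3 periodicity: the word carrier has period `period`, the level `m` field has period `physPeriod m`, and
  under `Permissible` (commensurable periods) every level `m ≥ 1` — hence the summed carrier — has period
  `physPeriod 1`.
-/

set_option linter.dupNamespace false

noncomputable section

namespace Summit.AnomalousDissipation.AnomalousDissipation.Theorems.SolenoidalFractalHomogenisation.PermissibleCarrier

open Set Filter Topology MeasureTheory
open scoped ENNReal NNReal
open Literature.Analysis Literature.Analysis.FunctionSpaces Literature.Analysis.FunctionSpaces.Torus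
open Literature.Analysis.FluidPDE Literature.Analysis.FluidPDE.LatticeShear

/-! ## §1 Slots and the replayed envelope -/

section Slots

variable {k : ℕ}

/-- Slot starts are nonnegative. [folklore] -/
theorem start_nonneg (W : LatticeWord k) (j : Fin k) : 0 ≤ W.start j :=
  Finset.sum_nonneg fun i _ => (W.phase i).τ_pos.le

/-- Every slot ends within the period: `start j + τ j ≤ period`. [folklore] -/
theorem start_add_tau_le_period (W : LatticeWord k) (j : Fin k) : W.start j + (W.phase j).τ ≤ W.period := by
  unfold LatticeWord.start LatticeWord.period
  have hj : j ∉ Finset.univ.filter (· < j) := by simp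
  calc ∑ i ∈ Finset.univ.filter (· < j), (W.phase i).τ + (W.phase j).τ
      = ∑ i ∈ insert j (Finset.univ.filter (· < j)), (W.phase i).τ := by rw [Finset.sum_insert hj, add_comm]
    _ ≤ ∑ i, (W.phase i).τ := Finset.sum_le_univ_sum_of_nonneg fun i => (W.phase i).τ_pos.le

/-- The period of a word is positive. [folklore] -/
theorem period_pos (W : LatticeWord k) : 0 < W.period := by
  unfold LatticeWord.period
  have hne : (Finset.univ : Finset (Fin k)).Nonempty := ⟨⟨0, W.pos⟩, Finset.mem_univ _⟩
  exact Finset.sum_pos (fun i _ => (W.phase i).τ_pos) hne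

/-- The envelope of slot `j` vanishes at time `0` of the period. [folklore] -/
theorem trapezoid_start_zero (W : LatticeWord k) (j : Fin k) :
    LatticeWord.trapezoid (W.start j) (W.phase j).τ W.ramp 0 = 0 :=
  trapezoid_eq_zero_of_le (mul_pos W.ramp_pos (W.phase j).τ_pos) (start_nonneg W j)

/-- The envelope of slot `j` vanishes at the end of the period. [folklore] -/
theorem trapezoid_start_period (W : LatticeWord k) (j : Fin k) :
    LatticeWord.trapezoid (W.start j) (W.phase j).τ W.ramp W.period = 0 :=
  trapezoid_eq_zero_of_ge (mul_pos W.ramp_pos (W.phase j).τ_pos) (start_add_tau_le_period W j)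

/-- **The periodically replayed envelope is continuous in time**: `t ↦ trapezoid_j (fract (a t / period) · period)`
is continuous (the envelope vanishes at both ends of the period). [folklore] -/
theorem continuous_trapezoid_fract (W : LatticeWord k) (j : Fin k) (a : ℝ) :
    Continuous fun t : ℝ => LatticeWord.trapezoid (W.start j) (W.phase j).τ W.ramp
      (Int.fract (a * t / W.period) * W.period) := by
  set g : ℝ → ℝ := fun u => LatticeWord.trapezoid (W.start j) (W.phase j).τ W.ramp (u * W.period) with hg
  have hgc : Continuous g := (continuous_trapezoid _ _ _).comp (continuous_id.mul continuous_const)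
  have h01 : g 0 = g 1 := by
    simp only [hg, zero_mul, one_mul, trapezoid_start_zero, trapezoid_start_period]
  have hper : Continuous (g ∘ Int.fract) := ContinuousOn.comp_fract'' hgc.continuousOn h01
  exact hper.comp ((continuous_const.mul continuous_id).div_const _)

end Slots

/-! ## §2 Continuity of the levels in time, in `C^{0,r}` -/

section Continuity

variable {k : ℕ}

/-- **The level fields are continuous in time with values in `C^{0,r}`** (`r ≤ 1`):
`‖level m t − level m t₀‖_{C^{0,r}} → 0` as `t → t₀`. [folklore] -/
theorem tendsto_eBoundedHolderNorm_level_sub (D : FractalCarrierData k) (m : ℕ) (t₀ : ℝ) {r : ℝ≥0} (hr : r ≤ 1)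
    (S : Set ℝ) :
    Tendsto (fun t => eBoundedHolderNorm r (D.level m t - D.level m t₀)) (𝓝[S] t₀) (𝓝 0) := by
  -- the real majorant `F t = 7 a N^{r-1} Σⱼ |Δⱼ(t)|` is continuous and vanishes at `t₀`
  set W := D.word m with hW
  set F : ℝ → ℝ := fun t => 7 * D.a m * (D.N m : ℝ) ^ ((r : ℝ) - 1) *
      ∑ j, |LatticeWord.trapezoid (W.start j) (W.phase j).τ W.ramp (Int.fract (D.a m * t / W.period) * W.period) -
        LatticeWord.trapezoid (W.start j) (W.phase j).τ W.ramp (Int.fract (D.a m * t₀ / W.period) * W.period)| with hF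
  have hFc : Continuous F := by
    refine continuous_const.mul (continuous_finsetSum _ fun j _ => ?_)
    exact ((continuous_trapezoid_fract W j (D.a m)).sub continuous_const).abs
  have hF0 : F t₀ = 0 := by simp [hF]
  have hT : Tendsto (fun t => ENNReal.ofReal (F t)) (𝓝[S] t₀) (𝓝 0) := by
    have h := ((ENNReal.continuous_ofReal.comp hFc).tendsto t₀).mono_left (nhdsWithin_le_nhds (s := S))
    simp only [Function.comp_def, hF0, ENNReal.ofReal_zero] at h
    exact h
  refine tendsto_of_tendsto_of_tendsto_of_le_of_le tendsto_const_nhds hT (fun t => bot_le) fun t => ?_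
  exact eBoundedHolderNorm_level_sub_le D m t t₀ hr

end Continuity

/-! ## §3 Periodicity -/

section Periodicity

variable {k : ℕ}

/-- The word carrier is periodic in time with period `period`. [folklore] -/
theorem carrier_add_period (W : LatticeWord k) (s : ℝ) : W.carrier (s + W.period) = W.carrier s := by
  funext y
  have hp : W.period ≠ 0 := (period_pos W).ne'
  simp only [LatticeWord.carrier, add_div, div_self hp, Int.fract_add_one]

/-- The level `m` field is periodic in time with period `physPeriod m`. [folklore] -/
theorem periodic_level (D : FractalCarrierData k) (m : ℕ) : Function.Periodic (D.level m) (D.physPeriod m) := by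
  intro t
  funext x
  have ha : D.a m ≠ 0 := (D.a_pos m).ne'
  simp only [FractalCarrierData.level, LatticeWord.cell, FractalCarrierData.physPeriod]
  rw [mul_add, mul_div_cancel₀ _ ha, carrier_add_period]

/-- The physical period of every level is positive. [folklore] -/
theorem physPeriod_pos (D : FractalCarrierData k) (m : ℕ) : 0 < D.physPeriod m :=
  div_pos (period_pos _) (D.a_pos m)

/-- Under commensurability (`Permissible`), `physPeriod 1` is a positive integer multiple of every
`physPeriod m`, `m ≥ 1`. [cite: ArmstrongVicol2025, §3 (commensurable periods of the levels)] -/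
theorem exists_physPeriod_one_eq_mul (D : FractalCarrierData k) (hP : D.Permissible) :
    ∀ m : ℕ, 1 ≤ m → ∃ q : ℕ, 0 < q ∧ D.physPeriod 1 = q * D.physPeriod m := by
  obtain ⟨-, -, -, -, -, -, -, hcomm, -⟩ := hP
  intro m hm
  induction m with
  | zero => exact absurd hm (by norm_num)
  | succ n ih =>
    rcases Nat.eq_zero_or_pos n with hn | hn
    · subst hn
      exact ⟨1, one_pos, by simp⟩
    · obtain ⟨q, hq, hq'⟩ := ih hn
      obtain ⟨r, hr, hr'⟩ := hcomm n
      refine ⟨q * r, Nat.mul_pos hq hr, ?_⟩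
      rw [hq', ← hr']
      push_cast
      ring

/-- Under `Permissible` every level `m ≥ 1` has period `physPeriod 1`. [folklore] -/
theorem periodic_level_physPeriod_one (D : FractalCarrierData k) (hP : D.Permissible) {m : ℕ} (hm : 1 ≤ m) :
    Function.Periodic (D.level m) (D.physPeriod 1) := by
  obtain ⟨q, -, hq⟩ := exists_physPeriod_one_eq_mul D hP m hm
  rw [hq]
  exact (periodic_level D m).nat_mul q

/-- Under `Permissible` the summed carrier has period `physPeriod 1 > 0`. [folklore] -/
theorem periodic_carrier (D : FractalCarrierData k) (hP : D.Permissible) :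
    Function.Periodic D.carrier (D.physPeriod 1) := by
  intro t
  funext x
  simp only [FractalCarrierData.carrier]
  refine tsum_congr fun m => ?_
  have h := periodic_level_physPeriod_one D hP (Nat.le_add_left 1 m)
  rw [h t]

end Periodicity

end Summit.AnomalousDissipation.AnomalousDissipation.Theorems.SolenoidalFractalHomogenisation.PermissibleCarrier

end
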